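import Summits.BirchSwinnertonDyer.BirchSwinnertonDyer.Theorems.GenusKolyvaginAtTwoGenusDeepSupplyAtTwoNegDiscNarrowKFourCellShaTwoRank
import HarnessLib

/-!
# Route `GenusKolyvaginAtTwo`, crux 23491, K₄ cell: EVERY `Gal(K/ℚ)`-INVARIANT `2`-SELMER CLASS OF `E_K` IS THE RESTRICTION OF A UNIQUE
# `2`-SELMER CLASS OF `E/ℚ` — the home of Kolyvagin's level-1 deep classes `c₁(ℓ)` on the positive-depth cell

LEAD seat `bsd-line-gk2-p1` g22, `--supports stmt-BirchSwinnertonDyer-23491 --as helper`; sequel of p765489 / p765896.  THEOREMS ONLY; conditional only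
on the two displayed print facts hPT / hEP.  **BSD is NOT proved by this file, no item is closed, the registered stub C‴ is untouched.**

WHY.  On the K₄ cell (`Δ<0`, `#Sel₂(E) = 4`, `M₀ ≥ 1`) every level-1 deep Kolyvagin class `c₁(ℓ) ∈ H¹(K, E[2])` is (i) a SELMER class of `E_K`
(Gross Prop. 6.2 at a deep prime, `d(ℓ)_λ = 0` since `y_K ∈ 2E(K)`; cdisprove g0 §3; mod Q2 in the tree's currency) and (ii) `τ`-INVARIANT
(`τ·c = ±c = c` in `2`-torsion).  This file says where such classes live: **`Sel₂(E_K/K)^{τ} = res_K Sel₂(E/ℚ)`, a group of order `4`, `res_K`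
injective** — so a class as in (i)+(ii) is `res_K s` for a UNIQUE `s ∈ Sel₂(E/ℚ)` (`≅ Ш(E/ℚ)[2] ≅ (ℤ/2)²` on the cell), and it is non-zero iff
`s ≠ 0`.  READING: **K₄ at the single deep prime `ℓ` ⟺ `c₁(ℓ) = res_K s` with `s` one of the THREE non-zero classes of `Sel₂(E/ℚ)`** — Kolyvagin's
own mechanism for bounding `Ш(E/ℚ)` read as an existence statement («the first deep derivative class REALISES a non-zero element of `Ш(E/ℚ)[2]`»).

* `existsUnique_mem_selmerGroup_resTorsion_eq_of_cell` — the unique descent of an invariant Selmer class to `Sel₂(E/ℚ)` on the cell;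
* `resTorsion_eq_zero_iff` — `res_K s = 0 ↔ s = 0` (so the descended class is non-zero iff the invariant class is).

References: [GrossLMS1991] §5 (5.1), Prop. 6.2, §11 (Question 11); [Kramer1981] Thm. 1; [McCallumLMS1991] §4 Lemma 4.3, Prop. 4.4.
-/

set_option linter.dupNamespace false -- tree convention: `Summit.BirchSwinnertonDyer.BirchSwinnertonDyer.Theorems` (summit = sub-problem)
set_option autoImplicit false

noncomputable section

open scoped Classical

namespace Summit.BirchSwinnertonDyer.BirchSwinnertonDyer.Theorems.GenusSupplyNarrow.KFourCell

open WeierstrassCurve NumberField IsDedekindDomain Field Function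
open Literature.NumberTheory.EllipticCurves Literature.NumberTheory.GaloisRepresentations
open Literature.NumberTheory.GaloisCohomology
open Literature.Barriers.BirchSwinnertonDyer (Matsuno2009.primePlace)
open Rat.HeightOneSpectrum (primesEquiv)
open Summit.BirchSwinnertonDyer.Rank1Residual.X11b.KummerPT (kummerRelaxed)
open Summit.BirchSwinnertonDyer.BirchSwinnertonDyer.Theorems.KolyvaginRatDescentTwo (mem_selmerGroup_kummerRelaxed_singleton_iff)

variable (W : WeierstrassCurve ℚ) [W.IsElliptic] [W.IsGloballyMinimal] (K : Type) [Field K] [NumberField K]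

omit [W.IsElliptic] [W.IsGloballyMinimal] in
/-- `res_K s = 0 ↔ s = 0` for `E(K)[2] = 0` (`res_K` injective, `EigenClassesFinite.resTorsion_injective_of_noTorsion`). [cite: GrossLMS1991, §5 (5.1)] -/
theorem resTorsion_eq_zero_iff (h2 : Module.finrank ℚ K = 2)
    (hL : ∀ P : (W.baseChange K).toAffine.Point, ((2 : ℕ) : ℤ) • P = 0 → P = 0) (s : galH1Torsion W ((2 : ℕ) : ℤ)) :
    resTorsion W K ((2 : ℕ) : ℤ) s = 0 ↔ s = 0 := by
  obtain ⟨θ, hθ, hc⟩ := Literature.NumberTheory.EllipticCurves.exists_sq_eq_discr_not_mem_range K h2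
  have hinj := GenusExact.EigenClassesFinite.resTorsion_injective_of_noTorsion W K h2 hθ hc ((2 : ℕ) : ℤ) hL
  refine ⟨fun h ↦ hinj (by rw [h, map_zero]), fun h ↦ by rw [h, map_zero]⟩

/-- **UNIQUE DESCENT OF AN INVARIANT `2`-SELMER CLASS OF `E_K` TO `Sel₂(E/ℚ)` ON THE K₄ CELL.**  Cell hypotheses (p765896 §1): `E/ℚ` globally
minimal, `Δ_E < 0`, `#Sel₂(E) = 4`; `K = ℚ(√−ℓ)` imaginary quadratic (`d_K = −ℓ` odd, `ℓ` prime), Heegner for `N_E`, `2` split; `Wd` a model of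
`E^{(d_K)}` with `#Sel₂(Wd) = 2`; `E(K)[2] = 0`; print facts hPT/hEP.  Then for EVERY non-trivial `σ₀ ∈ Aut(K/ℚ)` and every `m ∈ Sel₂(E_K/K)` with
`σ₀·m = m` there is a UNIQUE `s ∈ H¹(ℚ, E[2])` with `res_K s = m`, and it lies in `Sel₂(E/ℚ)`.  (p765489 §5: `m = res_K x` with `x` in the
`{ℓ,∞}`-relaxed group; p765896 §1: on the cell that group IS `Sel₂(E)`; uniqueness: `res_K` injective.)  Home of the level-1 deep Kolyvagin
classes `c₁(ℓ)` (Selmer by Gross 6.2, invariant in `2`-torsion).  [cite: Kramer1981, Thm. 1] [cite: GrossLMS1991, §5 (5.1), Prop. 6.2, §11] -/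
theorem existsUnique_mem_selmerGroup_resTorsion_eq_of_cell
    (hPT : poitouTate_selmerStructure_duality_real ℚ)
    (hEP : ∀ v : HeightOneSpectrum (𝓞 ℚ), localEulerPoincareCharacteristic (v.adicCompletion ℚ))
    (hΔ : W.Δ < 0) (h4 : Nat.card (W.selmerGroup 2) = 4) (hK : IsImaginaryQuadratic K) (hodd : Odd (discr K))
    (hH : SatisfiesHeegnerHypothesis (W.conductorNorm ℤ) K) (h2K : ((Ideal.span {(2 : ℤ)}).primesOver (𝓞 K)).ncard = 2)
    {ℓ : ℕ} [Fact ℓ.Prime] (hd : discr K = -(ℓ : ℤ))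
    (Wd : WeierstrassCurve ℚ) [Wd.IsElliptic] (hWd : ∃ C : VariableChange ℚ, C • W.quadraticTwist (discr K : ℚ) = Wd)
    (hSel : Nat.card (Wd.selmerGroup 2) = 2)
    (hL : ∀ P : (W.baseChange K).toAffine.Point, ((2 : ℕ) : ℤ) • P = 0 → P = 0)
    {σ₀ : K ≃ₐ[ℚ] K} (hσ₀ : σ₀ ≠ 1)
    {m : galH1Torsion (W.baseChange K) ((2 : ℕ) : ℤ)} (hm : m ∈ selmerGroup (W.baseChange K) ((2 : ℕ) : ℤ))
    (hσm : conjAct W σ₀ ((2 : ℕ) : ℤ) m = m) :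
    ∃! s : galH1Torsion W ((2 : ℕ) : ℤ), resTorsion W K ((2 : ℕ) : ℤ) s = m ∧ s ∈ W.selmerGroup ((2 : ℕ) : ℤ) := by
  have h2 : Module.finrank ℚ K = 2 := hK.1
  have hℓ : ℓ.Prime := Fact.out
  obtain ⟨v₀, hv₀⟩ : ∃ v : HeightOneSpectrum (𝓞 ℚ), ((primesEquiv v : Nat.Primes) : ℕ) = ℓ :=
    ⟨primesEquiv.symm ⟨ℓ, hℓ⟩, by rw [Equiv.apply_symm_apply]⟩
  have hpp : Matsuno2009.primePlace ℓ = v₀ := primePlace_eq_of_primesEquiv_eq hℓ hv₀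
  have hℓv₀ : (ℓ : 𝓞 ℚ) ∈ v₀.asIdeal := by
    rw [← hv₀]
    exact Rat.HeightOneSpectrum.natCast_natGenerator_mem v₀
  obtain ⟨hℓ2, hℓN, -⟩ := GenusKolyTwin.prime_discr_facts W hK hodd hH hℓ hd
  have h2v₀ : ((2 : ℕ) : 𝓞 ℚ) ∉ v₀.asIdeal :=
    GenusKolyTwistingPrime.natCast_not_mem_of_not_dvd hℓ hℓv₀ fun h ↦
      hℓ2 ((Nat.prime_dvd_prime_iff_eq hℓ Nat.prime_two).mp h)
  have hgood : W.HasGoodReductionAt v₀ := by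
    by_contra h
    exact hℓN (hv₀ ▸ (W.dvd_conductorNorm_iff v₀).mpr h)
  -- descent to the `{ℓ,∞}`-relaxed group (p765489 §5)
  obtain ⟨x, hx, hxm⟩ := (RamifiedDescent.mem_selmerGroup_and_conjAct_eq_iff_exists_relaxed W K hK hH h2K hodd hℓ hd
    (hpp ▸ h2v₀) (hpp ▸ hgood) hL hσ₀ m).mp ⟨hm, hσm⟩
  -- on the cell that group is `Sel₂(E)` (p765896 §1)
  have hcell := (natCard_kummerRelaxed_eq_four_of_cell W hPT hEP hΔ hK hodd hH h2K hd h4 Wd hWd hSel hv₀).1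
  have hxS : x ∈ W.selmerGroup ((2 : ℕ) : ℤ) := by
    have hx' : x ∈ (kummerRelaxed W 2 {(Sum.inr v₀ : Place ℚ)}).selmerGroup :=
      (mem_selmerGroup_kummerRelaxed_singleton_iff W v₀ x).mpr ⟨fun v hv ↦ hx v (by rwa [hpp]), fun w ↦
        GenusExact.ArchVanishing.mem_selmerLocalKer_infinitePlace_of_Δ_neg W w hΔ _ x⟩
    have hS : W.selmerGroup ((2 : ℕ) : ℤ) = (W.kummerSelmerStructure ((2 : ℕ) : ℤ)).selmerGroup :=
      selmerGroup_eq_selmerGroup_kummerSelmerStructure W 2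
    rw [hS]
    exact hcell ▸ hx'
  refine ⟨x, ⟨hxm, hxS⟩, fun y hy ↦ ?_⟩
  obtain ⟨θ, hθ, hc⟩ := Literature.NumberTheory.EllipticCurves.exists_sq_eq_discr_not_mem_range K h2
  exact GenusExact.EigenClassesFinite.resTorsion_injective_of_noTorsion W K h2 hθ hc ((2 : ℕ) : ℤ) hL (hy.1.trans hxm.symm)

end Summit.BirchSwinnertonDyer.BirchSwinnertonDyer.Theorems.GenusSupplyNarrow.KFourCell

end
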